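import Summits.CriticalPhenomena.PercolationContinuityZ3.Theorems.PercNearOneGluingNoHeavyQuantFarTwoTerminalReach
import Summits.CriticalPhenomena.PercolationContinuityZ3.Theorems.PercNearOneGluingNoHeavyQuantFarBlockLaw
import HarnessLib

/-!
# QUANT lane R8, front "FAR beyond trees", layer one — TWO-TERMINAL BLOCKS II: the law decomposition by outside type and the
# TWO-TERMINAL EXIT LEMMA (an environment-free certificate for FAR at layer one)

builds on p205010 (kernel theorem, internal audit signed; external expert review pending)

Support file (`--supports stmt-CriticalPhenomena-4575`), seat `prim-quant-p1` (gen 25); memo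
`run/shared/lean/prim/quant/prim-quant-p1-g25/FOR-LEAD-TWOTERMINAL.md` §2–§3.  Standard axioms; no sorries; no definitions.
Two-terminal analogue of `…QuantFarBlockLaw` / `…QuantFarBlockOutsideExit` (one cut vertex).

For a weight function `v` vanishing on every pair between the block `Z` and `(Z ∪ {c₁, c₂})ᶜ` (`o, c₁, c₂ ∉ Z`) the configuration is almost
surely good (every open pair leaving `Z` ends at a terminal), so (`…TwoTerminalReach`) the relays of `Z` reached by `o` are those joined ON `Z` to the terminals that `o` reaches OFF
`Z`.  With the OUTSIDE TYPES `O₁ = {o ~ c₁ ∧ ¬ o ~ c₂ off Z}`, `O₂`, `O₁₂ = {o ~ c₁ ∧ o ~ c₂ off Z}` (determined by the pairs avoiding `Z`)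
and the inside events read off `onZ Z` (determined by the pairs meeting `Z`), independence of disjoint coordinate sets gives:
* `Block.real_openConn_in₂_eq` — **marginal of a block vertex** `a ∈ Z`:
  `P(o ↔ a) = P(O₁)·P(c₁ ~ a on Z) + P(O₂)·P(c₂ ~ a on Z) + P(O₁₂)·P(c₁ ~ a ∨ c₂ ~ a on Z)`;
* `Block.real_two_le_card_ge₂` — **lower bound for two relays** (any weights, no vanishing hypothesis):
  `P(N ≥ 2) ≥ P(O₁)·P(X₁ ≥ 2) + P(O₂)·P(X₂ ≥ 2) + P(O₁₂)·P(X₁₂ ≥ 2)`, `X₁ = #{a ∈ A ∩ Z : c₁ ~ a on Z}`, `X₂` likewise,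
  `X₁₂ = #{a ∈ A ∩ Z : c₁ ~ a ∨ c₂ ~ a on Z}`;
* **`Block.real_card_le_one_le_of_exit₂` — THE TWO-TERMINAL EXIT LEMMA**: if some relay `a ∈ A ∩ Z` is "probabilistically shielded inside
  the block", i.e. `P(c₁ ~ a on Z) ≤ P(X₁ ≥ 2)`, `P(c₂ ~ a on Z) ≤ P(X₂ ≥ 2)` and `P(c₁ ~ a ∨ c₂ ~ a on Z) ≤ P(X₁₂ ≥ 2)`, then
  `P(#{x ∈ A : o ↔ x} ≤ 1) ≤ P(o ↮ a)` — WHATEVER the rest of the graph is (no hypothesis on the environment, none on the mean).  Hence the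
  layer-one instance of `Quant.FarRelayRow` holds for every such graph (`Block.farLayerOne_of_exit₂`: `P(o ↮ x) ≤ t` on `A` gives `P(N ≤ 1) ≤ t`).
  Example (memo §3): a decorated ear `c₁ – v₁ – ⋯ – v_L – c₂` of a 2-connected core whose middle relay has relays on both sides — with sure
  relays this is the elementary "shielded relay"; with coin relays / long ears the three inequalities are the exact condition.
This is the first ENVIRONMENT-FREE two-terminal certificate; the general two-terminal criterion (LP over outside types, memo §4–§6) is open.
[cite: Grimmett1999, §1.3 p. 10; §2.2] (product measure; events determined by finitely many coordinates); bookkeeping [this work].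
-/

noncomputable section

namespace Summit.CriticalPhenomena.PercolationContinuityZ3.Theorems

namespace Quant

namespace Block

open Finset MeasureTheory Set
open Literature.Probability.LatticeModels
open Literature.Probability.Percolation
open Bundle (offZ avoid offZ_eq_inter determinedBy_offZ)
open scoped Classical

variable {n : ℕ}

section Law

variable {o c₁ c₂ : Fin n} {Z : Finset (Fin n)}

/-- If `v` vanishes on every pair between `Z` and `(Z ∪ {c₁, c₂})ᶜ`, the configuration is almost surely two-terminal good: events
agreeing on good configurations have the same probability. [this work] -/
theorem real_congr_of_twoTerminal (v : Sym2 (Fin n) → unitInterval)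
    (hv : ∀ x y : Fin n, x ≠ y → x ∈ Z → y ∉ Z → y ≠ c₁ → y ≠ c₂ → (v s(x, y) : ℝ) = 0)
    (S T : Set (BondConfig (Fin n))) (hST : ∀ ω, (∀ x y : Fin n, x ≠ y → s(x, y) ∈ ω → x ∈ Z → y ∉ Z → y = c₁ ∨ y = c₂) → (ω ∈ S ↔ ω ∈ T)) :
    (prodBernoulli v).real S = (prodBernoulli v).real T := by
  set μ := prodBernoulli v with hμ
  set Bd : Finset (Sym2 (Fin n)) := Finset.univ.filter fun e =>
    ∃ x y : Fin n, x ≠ y ∧ e = s(x, y) ∧ x ∈ Z ∧ y ∉ Z ∧ y ≠ c₁ ∧ y ≠ c₂ with hBd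
  set Nbad : Set (BondConfig (Fin n)) := {ω | ∃ e ∈ Bd, e ∈ ω} with hN
  have hmeas : ∀ U : Set (BondConfig (Fin n)), MeasurableSet U := fun U => (Set.toFinite U).measurableSet
  have hN0 : μ.real Nbad = 0 := by
    have h0 : μ Nbad = 0 := by
      apply prodBernoulli_setOf_exists_mem_eq_zero
      intro e he
      obtain ⟨x, y, hxy, rfl, hx, hy, hy1, hy2⟩ := (Finset.mem_filter.1 he).2
      exact hv x y hxy hx hy hy1 hy2
    simp [measureReal_def, h0]
  have hgood : ∀ ω : BondConfig (Fin n), ω ∉ Nbad →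
      ∀ x y : Fin n, x ≠ y → s(x, y) ∈ ω → x ∈ Z → y ∉ Z → y = c₁ ∨ y = c₂ := by
    intro ω hω x y hxy he hx hy
    by_contra hyc
    obtain ⟨hy1, hy2⟩ := not_or.1 hyc
    exact hω ⟨s(x, y), Finset.mem_filter.2 ⟨Finset.mem_univ _, x, y, hxy, rfl, hx, hy, hy1, hy2⟩, he⟩
  have hsplit : ∀ U : Set (BondConfig (Fin n)), μ.real U = μ.real (U \ Nbad) := by
    intro U
    have h := measureReal_inter_add_sdiff (μ := μ) (s := U) (hmeas Nbad)
    have h0 : μ.real (U ∩ Nbad) = 0 :=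
      le_antisymm ((measureReal_mono Set.inter_subset_right).trans hN0.le) measureReal_nonneg
    linarith
  have hdiff : S \ Nbad = T \ Nbad := by
    ext ω
    simp only [Set.mem_sdiff]
    constructor
    · rintro ⟨hS, hω⟩; exact ⟨(hST ω (hgood ω hω)).1 hS, hω⟩
    · rintro ⟨hT, hω⟩; exact ⟨(hST ω (hgood ω hω)).2 hT, hω⟩
  rw [hsplit S, hsplit T, hdiff]

/-- **Marginal of a block vertex, by outside type.**  For `a ∈ Z` (`o ∉ Z`, weights vanishing between `Z` and `(Z ∪ {c₁,c₂})ᶜ`):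
`P(o ↔ a) = P(O₁)·P(c₁ ~ a on Z) + P(O₂)·P(c₂ ~ a on Z) + P(O₁₂)·P(c₁ ~ a ∨ c₂ ~ a on Z)`. [this work] -/
theorem real_openConn_in₂_eq (v : Sym2 (Fin n) → unitInterval) (ho : o ∉ Z)
    (hv : ∀ x y : Fin n, x ≠ y → x ∈ Z → y ∉ Z → y ≠ c₁ → y ≠ c₂ → (v s(x, y) : ℝ) = 0) {a : Fin n} (ha : a ∈ Z) :
    (prodBernoulli v).real (openConn o a) =
      (prodBernoulli v).real {ω | offZ Z ω ∈ openConn o c₁ ∧ offZ Z ω ∉ openConn o c₂} *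
          (prodBernoulli v).real {ω | onZ Z ω ∈ openConn c₁ a} +
        (prodBernoulli v).real {ω | offZ Z ω ∉ openConn o c₁ ∧ offZ Z ω ∈ openConn o c₂} *
          (prodBernoulli v).real {ω | onZ Z ω ∈ openConn c₂ a} +
        (prodBernoulli v).real {ω | offZ Z ω ∈ openConn o c₁ ∧ offZ Z ω ∈ openConn o c₂} *
          (prodBernoulli v).real {ω | onZ Z ω ∈ openConn c₁ a ∨ onZ Z ω ∈ openConn c₂ a} := by
  set μ := prodBernoulli v with hμ
  have hmeas : ∀ U : Set (BondConfig (Fin n)), MeasurableSet U := fun U => (Set.toFinite U).measurableSet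
  set O1 := {ω : BondConfig (Fin n) | offZ Z ω ∈ openConn o c₁ ∧ offZ Z ω ∉ openConn o c₂} with hO1
  set O2 := {ω : BondConfig (Fin n) | offZ Z ω ∉ openConn o c₁ ∧ offZ Z ω ∈ openConn o c₂} with hO2
  set O12 := {ω : BondConfig (Fin n) | offZ Z ω ∈ openConn o c₁ ∧ offZ Z ω ∈ openConn o c₂} with hO12
  set Y1 := {ω : BondConfig (Fin n) | onZ Z ω ∈ openConn c₁ a} with hY1
  set Y2 := {ω : BondConfig (Fin n) | onZ Z ω ∈ openConn c₂ a} with hY2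
  set Y12 := {ω : BondConfig (Fin n) | onZ Z ω ∈ openConn c₁ a ∨ onZ Z ω ∈ openConn c₂ a} with hY12
  set T := O1 ∩ Y1 ∪ O2 ∩ Y2 ∪ O12 ∩ Y12 with hT
  have hST : μ.real (openConn o a) = μ.real T := by
    refine real_congr_of_twoTerminal (c₁ := c₁) (c₂ := c₂) (Z := Z) v hv _ _ fun ω hω => ?_
    simp only [hT, hO1, hO2, hO12, hY1, hY2, hY12, Set.mem_union, Set.mem_inter_iff, mem_setOf_eq]
    show (openGraph ω).Reachable o a ↔ _
    by_cases h₁ : (openGraph (offZ Z ω)).Reachable o c₁ <;> by_cases h₂ : (openGraph (offZ Z ω)).Reachable o c₂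
    · rw [reach_in₂_iff_of_both hω ho h₁ h₂ ha]
      exact ⟨fun h => Or.inr ⟨⟨h₁, h₂⟩, h⟩, fun h => by
        rcases h with (⟨⟨-, h'⟩, -⟩ | ⟨⟨h', -⟩, -⟩) | ⟨-, h⟩
        · exact absurd h₂ h'
        · exact absurd h₁ h'
        · exact h⟩
    · rw [reach_in₂_iff_of_one hω ho h₁ h₂ ha]
      exact ⟨fun h => Or.inl (Or.inl ⟨⟨h₁, h₂⟩, h⟩), fun h => by
        rcases h with (⟨-, h⟩ | ⟨⟨-, h'⟩, -⟩) | ⟨⟨-, h'⟩, -⟩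
        · exact h
        · exact absurd h' h₂
        · exact absurd h' h₂⟩
    · rw [reach_in₂_iff_of_two hω ho h₁ h₂ ha]
      exact ⟨fun h => Or.inl (Or.inr ⟨⟨h₁, h₂⟩, h⟩), fun h => by
        rcases h with (⟨⟨h', -⟩, -⟩ | ⟨-, h⟩) | ⟨⟨h', -⟩, -⟩
        · exact absurd h' h₁
        · exact h
        · exact absurd h' h₁⟩
    · constructor
      · intro h; exact absurd h (not_reach_in₂_of_none hω ho h₁ h₂ ha)
      · intro h
        rcases h with (⟨⟨h', -⟩, -⟩ | ⟨⟨-, h'⟩, -⟩) | ⟨⟨h', -⟩, -⟩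
        · exact absurd h' h₁
        · exact absurd h' h₂
        · exact absurd h' h₁
  have hd1 : Disjoint (O1 ∩ Y1) (O2 ∩ Y2) := by
    rw [Set.disjoint_left]; rintro ω ⟨⟨h, -⟩, -⟩ ⟨⟨h', -⟩, -⟩; exact h' h
  have hd2 : Disjoint (O1 ∩ Y1 ∪ O2 ∩ Y2) (O12 ∩ Y12) := by
    rw [Set.disjoint_left]; rintro ω (⟨⟨-, h⟩, -⟩ | ⟨⟨h, -⟩, -⟩) ⟨⟨h1, h2⟩, -⟩
    · exact h h2
    · exact h h1
  have hTsum : μ.real T = μ.real (O1 ∩ Y1) + μ.real (O2 ∩ Y2) + μ.real (O12 ∩ Y12) := by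
    rw [hT, measureReal_union hd2 (hmeas _), measureReal_union hd1 (hmeas _)]
  have hdO1 : DeterminedBy O1 (↑(avoid Z) : Set (Sym2 (Fin n))) :=
    determinedBy_offZ Z fun η => η ∈ openConn o c₁ ∧ η ∉ openConn o c₂
  have hdO2 : DeterminedBy O2 (↑(avoid Z) : Set (Sym2 (Fin n))) :=
    determinedBy_offZ Z fun η => η ∉ openConn o c₁ ∧ η ∈ openConn o c₂
  have hdO12 : DeterminedBy O12 (↑(avoid Z) : Set (Sym2 (Fin n))) :=
    determinedBy_offZ Z fun η => η ∈ openConn o c₁ ∧ η ∈ openConn o c₂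
  have hdY1 : DeterminedBy Y1 (↑(avoid Z) : Set (Sym2 (Fin n)))ᶜ := determinedBy_onZ Z fun η => η ∈ openConn c₁ a
  have hdY2 : DeterminedBy Y2 (↑(avoid Z) : Set (Sym2 (Fin n)))ᶜ := determinedBy_onZ Z fun η => η ∈ openConn c₂ a
  have hdY12 : DeterminedBy Y12 (↑(avoid Z) : Set (Sym2 (Fin n)))ᶜ :=
    determinedBy_onZ Z fun η => η ∈ openConn c₁ a ∨ η ∈ openConn c₂ a
  rw [hST, hTsum, prodBernoulli_real_inter_of_determinedBy v (avoid Z) hdO1 hdY1 (hmeas _) (hmeas _),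
    prodBernoulli_real_inter_of_determinedBy v (avoid Z) hdO2 hdY2 (hmeas _) (hmeas _),
    prodBernoulli_real_inter_of_determinedBy v (avoid Z) hdO12 hdY12 (hmeas _) (hmeas _)]

/-- **Lower bound for two reached relays, by outside type** (ANY weight function, any relay set `A`):
`P(N ≥ 2) ≥ P(O₁)·P(X₁ ≥ 2) + P(O₂)·P(X₂ ≥ 2) + P(O₁₂)·P(X₁₂ ≥ 2)`, where `X₁ = #{a ∈ A ∩ Z : c₁ ~ a on Z}`, `X₂` likewise and
`X₁₂ = #{a ∈ A ∩ Z : c₁ ~ a ∨ c₂ ~ a on Z}` — an off-`Z` path to a terminal followed by an on-`Z` path is an open path. [this work] -/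
theorem real_two_le_card_ge₂ (v : Sym2 (Fin n) → unitInterval) (o c₁ c₂ : Fin n) (Z A : Finset (Fin n)) :
    (prodBernoulli v).real {ω | offZ Z ω ∈ openConn o c₁ ∧ offZ Z ω ∉ openConn o c₂} *
          (prodBernoulli v).real {ω | 2 ≤ ((A ∩ Z).filter fun a => onZ Z ω ∈ openConn c₁ a).card} +
        (prodBernoulli v).real {ω | offZ Z ω ∉ openConn o c₁ ∧ offZ Z ω ∈ openConn o c₂} *
          (prodBernoulli v).real {ω | 2 ≤ ((A ∩ Z).filter fun a => onZ Z ω ∈ openConn c₂ a).card} +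
        (prodBernoulli v).real {ω | offZ Z ω ∈ openConn o c₁ ∧ offZ Z ω ∈ openConn o c₂} *
          (prodBernoulli v).real {ω | 2 ≤ ((A ∩ Z).filter fun a => onZ Z ω ∈ openConn c₁ a ∨ onZ Z ω ∈ openConn c₂ a).card} ≤
      (prodBernoulli v).real {ω : BondConfig (Fin n) | 2 ≤ (A.filter fun a => ω ∈ openConn o a).card} := by
  set μ := prodBernoulli v with hμ
  have hmeas : ∀ U : Set (BondConfig (Fin n)), MeasurableSet U := fun U => (Set.toFinite U).measurableSet
  set O1 := {ω : BondConfig (Fin n) | offZ Z ω ∈ openConn o c₁ ∧ offZ Z ω ∉ openConn o c₂} with hO1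
  set O2 := {ω : BondConfig (Fin n) | offZ Z ω ∉ openConn o c₁ ∧ offZ Z ω ∈ openConn o c₂} with hO2
  set O12 := {ω : BondConfig (Fin n) | offZ Z ω ∈ openConn o c₁ ∧ offZ Z ω ∈ openConn o c₂} with hO12
  set X1 := {ω : BondConfig (Fin n) | 2 ≤ ((A ∩ Z).filter fun a => onZ Z ω ∈ openConn c₁ a).card} with hX1
  set X2 := {ω : BondConfig (Fin n) | 2 ≤ ((A ∩ Z).filter fun a => onZ Z ω ∈ openConn c₂ a).card} with hX2
  set X12 := {ω : BondConfig (Fin n) |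
    2 ≤ ((A ∩ Z).filter fun a => onZ Z ω ∈ openConn c₁ a ∨ onZ Z ω ∈ openConn c₂ a).card} with hX12
  set S := {ω : BondConfig (Fin n) | 2 ≤ (A.filter fun a => ω ∈ openConn o a).card} with hS
  -- each piece lies in `S`
  have key : ∀ (ω : BondConfig (Fin n)) (T : Finset (Fin n)), T ⊆ A ∩ Z → (∀ a ∈ T, (openGraph ω).Reachable o a) →
      2 ≤ T.card → ω ∈ S := by
    intro ω T hTA hT h2
    simp only [hS, mem_setOf_eq]
    refine le_trans h2 (card_le_card fun a ha => ?_)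
    rw [mem_filter]
    exact ⟨(mem_inter.1 (hTA ha)).1, hT a ha⟩
  have hsub : O1 ∩ X1 ∪ O2 ∩ X2 ∪ O12 ∩ X12 ⊆ S := by
    rintro ω ((⟨⟨h₁, -⟩, hX⟩ | ⟨⟨-, h₂⟩, hX⟩) | ⟨⟨h₁, h₂⟩, hX⟩)
    · exact key ω ((A ∩ Z).filter fun a => onZ Z ω ∈ openConn c₁ a) (filter_subset _ _)
        (fun a ha => reach_in_of_off_on h₁ (mem_filter.1 ha).2) (by simpa only [hX1, mem_setOf_eq] using hX)
    · exact key ω ((A ∩ Z).filter fun a => onZ Z ω ∈ openConn c₂ a) (filter_subset _ _)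
        (fun a ha => reach_in_of_off_on h₂ (mem_filter.1 ha).2) (by simpa only [hX2, mem_setOf_eq] using hX)
    · exact key ω ((A ∩ Z).filter fun a => onZ Z ω ∈ openConn c₁ a ∨ onZ Z ω ∈ openConn c₂ a) (filter_subset _ _)
        (fun a ha => Or.elim (mem_filter.1 ha).2 (reach_in_of_off_on h₁) (reach_in_of_off_on h₂))
        (by simpa only [hX12, mem_setOf_eq] using hX)
  have hd1 : Disjoint (O1 ∩ X1) (O2 ∩ X2) := by
    rw [Set.disjoint_left]; rintro ω ⟨⟨h, -⟩, -⟩ ⟨⟨h', -⟩, -⟩; exact h' h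
  have hd2 : Disjoint (O1 ∩ X1 ∪ O2 ∩ X2) (O12 ∩ X12) := by
    rw [Set.disjoint_left]; rintro ω (⟨⟨-, h⟩, -⟩ | ⟨⟨h, -⟩, -⟩) ⟨⟨h1, h2⟩, -⟩
    · exact h h2
    · exact h h1
  have hdO1 : DeterminedBy O1 (↑(avoid Z) : Set (Sym2 (Fin n))) :=
    determinedBy_offZ Z fun η => η ∈ openConn o c₁ ∧ η ∉ openConn o c₂
  have hdO2 : DeterminedBy O2 (↑(avoid Z) : Set (Sym2 (Fin n))) :=
    determinedBy_offZ Z fun η => η ∉ openConn o c₁ ∧ η ∈ openConn o c₂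
  have hdO12 : DeterminedBy O12 (↑(avoid Z) : Set (Sym2 (Fin n))) :=
    determinedBy_offZ Z fun η => η ∈ openConn o c₁ ∧ η ∈ openConn o c₂
  have hdX1 : DeterminedBy X1 (↑(avoid Z) : Set (Sym2 (Fin n)))ᶜ :=
    determinedBy_onZ Z fun η => 2 ≤ ((A ∩ Z).filter fun a => η ∈ openConn c₁ a).card
  have hdX2 : DeterminedBy X2 (↑(avoid Z) : Set (Sym2 (Fin n)))ᶜ :=
    determinedBy_onZ Z fun η => 2 ≤ ((A ∩ Z).filter fun a => η ∈ openConn c₂ a).card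
  have hdX12 : DeterminedBy X12 (↑(avoid Z) : Set (Sym2 (Fin n)))ᶜ :=
    determinedBy_onZ Z fun η => 2 ≤ ((A ∩ Z).filter fun a => η ∈ openConn c₁ a ∨ η ∈ openConn c₂ a).card
  calc μ.real O1 * μ.real X1 + μ.real O2 * μ.real X2 + μ.real O12 * μ.real X12
      = μ.real (O1 ∩ X1) + μ.real (O2 ∩ X2) + μ.real (O12 ∩ X12) := by
        rw [prodBernoulli_real_inter_of_determinedBy v (avoid Z) hdO1 hdX1 (hmeas _) (hmeas _),
          prodBernoulli_real_inter_of_determinedBy v (avoid Z) hdO2 hdX2 (hmeas _) (hmeas _),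
          prodBernoulli_real_inter_of_determinedBy v (avoid Z) hdO12 hdX12 (hmeas _) (hmeas _)]
    _ = μ.real (O1 ∩ X1 ∪ O2 ∩ X2 ∪ O12 ∩ X12) := by
        rw [measureReal_union hd2 (hmeas _), measureReal_union hd1 (hmeas _)]
    _ ≤ μ.real S := measureReal_mono hsub (measure_ne_top _ _)

/-- **THE TWO-TERMINAL EXIT LEMMA.**  Block `Z` hanging at `c₁, c₂` (`o ∉ Z`, weights vanishing between `Z` and `(Z ∪ {c₁,c₂})ᶜ`), relay
set `A`, and a relay `a ∈ A ∩ Z` that is probabilistically shielded inside the block: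
`P(c₁ ~ a on Z) ≤ P(X₁ ≥ 2)`, `P(c₂ ~ a on Z) ≤ P(X₂ ≥ 2)`, `P(c₁ ~ a ∨ c₂ ~ a on Z) ≤ P(X₁₂ ≥ 2)` (notation of `real_two_le_card_ge₂`).
Then `P(#{x ∈ A : o ↔ x} ≤ 1) ≤ P(o ↮ a)` — no hypothesis on the rest of the graph and none on the mean. [this work] -/
theorem real_card_le_one_le_of_exit₂ (v : Sym2 (Fin n) → unitInterval) (ho : o ∉ Z)
    (hv : ∀ x y : Fin n, x ≠ y → x ∈ Z → y ∉ Z → y ≠ c₁ → y ≠ c₂ → (v s(x, y) : ℝ) = 0)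
    (A : Finset (Fin n)) {a : Fin n} (haA : a ∈ A) (haZ : a ∈ Z)
    (h₁ : (prodBernoulli v).real {ω | onZ Z ω ∈ openConn c₁ a} ≤
      (prodBernoulli v).real {ω | 2 ≤ ((A ∩ Z).filter fun x => onZ Z ω ∈ openConn c₁ x).card})
    (h₂ : (prodBernoulli v).real {ω | onZ Z ω ∈ openConn c₂ a} ≤
      (prodBernoulli v).real {ω | 2 ≤ ((A ∩ Z).filter fun x => onZ Z ω ∈ openConn c₂ x).card})
    (h₁₂ : (prodBernoulli v).real {ω | onZ Z ω ∈ openConn c₁ a ∨ onZ Z ω ∈ openConn c₂ a} ≤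
      (prodBernoulli v).real {ω | 2 ≤ ((A ∩ Z).filter fun x => onZ Z ω ∈ openConn c₁ x ∨ onZ Z ω ∈ openConn c₂ x).card}) :
    (prodBernoulli v).real {ω : BondConfig (Fin n) | (A.filter fun x => ω ∈ openConn o x).card ≤ 1} ≤
      (prodBernoulli v).real (openConn o a : Set (BondConfig (Fin n)))ᶜ := by
  set μ := prodBernoulli v with hμ
  have hmeas : ∀ U : Set (BondConfig (Fin n)), MeasurableSet U := fun U => (Set.toFinite U).measurableSet
  have _haAZ : a ∈ A ∩ Z := mem_inter.2 ⟨haA, haZ⟩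
  have hq := real_openConn_in₂_eq (c₁ := c₁) (c₂ := c₂) v ho hv haZ
  have hlow := real_two_le_card_ge₂ v o c₁ c₂ Z A
  have hcompl₁ : μ.real (openConn o a : Set (BondConfig (Fin n)))ᶜ = 1 - μ.real (openConn o a) :=
    probReal_compl_eq_one_sub (hmeas _)
  have hcompl₂ : μ.real {ω : BondConfig (Fin n) | (A.filter fun x => ω ∈ openConn o x).card ≤ 1} =
      1 - μ.real {ω : BondConfig (Fin n) | 2 ≤ (A.filter fun x => ω ∈ openConn o x).card} := by
    have : {ω : BondConfig (Fin n) | (A.filter fun x => ω ∈ openConn o x).card ≤ 1} =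
        {ω : BondConfig (Fin n) | 2 ≤ (A.filter fun x => ω ∈ openConn o x).card}ᶜ := by
      ext ω; simp only [mem_setOf_eq, Set.mem_compl_iff, not_le]; omega
    rw [this, probReal_compl_eq_one_sub (hmeas _)]
  have hO1 : 0 ≤ μ.real {ω | offZ Z ω ∈ openConn o c₁ ∧ offZ Z ω ∉ openConn o c₂} := measureReal_nonneg
  have hO2 : 0 ≤ μ.real {ω | offZ Z ω ∉ openConn o c₁ ∧ offZ Z ω ∈ openConn o c₂} := measureReal_nonneg
  have hO12 : 0 ≤ μ.real {ω | offZ Z ω ∈ openConn o c₁ ∧ offZ Z ω ∈ openConn o c₂} := measureReal_nonneg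
  rw [hcompl₁, hcompl₂, hq]
  nlinarith [mul_le_mul_of_nonneg_left h₁ hO1, mul_le_mul_of_nonneg_left h₂ hO2, mul_le_mul_of_nonneg_left h₁₂ hO12]

/-- **FAR at layer one from the two-terminal exit lemma** (route vocabulary): under the hypotheses of `real_card_le_one_le_of_exit₂`,
if `P(o ↮ x) ≤ t` for every `x ∈ A` then `P(#{x ∈ A : o ↔ x} ≤ 1) ≤ t` — the `j = 1` conclusion of `Quant.FarRelayRow` for this
graph, observer and relay set (the mean hypothesis `2 < Σ P(o ↔ x)` is not needed). [this work] -/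
theorem farLayerOne_of_exit₂ (v : Sym2 (Fin n) → unitInterval) (ho : o ∉ Z)
    (hv : ∀ x y : Fin n, x ≠ y → x ∈ Z → y ∉ Z → y ≠ c₁ → y ≠ c₂ → (v s(x, y) : ℝ) = 0)
    (A : Finset (Fin n)) {a : Fin n} (haA : a ∈ A) (haZ : a ∈ Z)
    (h₁ : (prodBernoulli v).real {ω | onZ Z ω ∈ openConn c₁ a} ≤
      (prodBernoulli v).real {ω | 2 ≤ ((A ∩ Z).filter fun x => onZ Z ω ∈ openConn c₁ x).card})
    (h₂ : (prodBernoulli v).real {ω | onZ Z ω ∈ openConn c₂ a} ≤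
      (prodBernoulli v).real {ω | 2 ≤ ((A ∩ Z).filter fun x => onZ Z ω ∈ openConn c₂ x).card})
    (h₁₂ : (prodBernoulli v).real {ω | onZ Z ω ∈ openConn c₁ a ∨ onZ Z ω ∈ openConn c₂ a} ≤
      (prodBernoulli v).real {ω | 2 ≤ ((A ∩ Z).filter fun x => onZ Z ω ∈ openConn c₁ x ∨ onZ Z ω ∈ openConn c₂ x).card})
    (t : ℝ) (hcut : ∀ x ∈ A, (prodBernoulli v).real (openConn o x : Set (BondConfig (Fin n)))ᶜ ≤ t) :
    (prodBernoulli v).real {ω : BondConfig (Fin n) | (A.filter fun x => ω ∈ openConn o x).card ≤ 1} ≤ t :=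
  (real_card_le_one_le_of_exit₂ v ho hv A haA haZ h₁ h₂ h₁₂).trans (hcut a haA)

end Law

end Block

end Quant

end Summit.CriticalPhenomena.PercolationContinuityZ3.Theorems
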